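import Mathlib
import HarnessLib

/-!
# Route `VirialFluxGap` (YangMills): INTEGRATION BY PARTS against an invariant measure along one-parameter translations,
# the GIBBS ∕ VIRIAL PAIRING `∫ (∂φ) e^{−βF} dμ = β ∫ φ (∂F) e^{−βF} dμ`, and the VIRIAL MEAN INEQUALITY

Toward the deciding crux `VirialFluxGap.PeriodicSoftness` (item stmt-QuantumFields-24141): the crux asks for the UPPER bound
`β⟨F₀⟩_β ≤ 9L⁴ − c` on the Gibbs mean of the zero-flux ring deficit (✓`RingDeficit.deficitFormZero`).  The virial route obtains it
from an EULER-TYPE VECTOR FIELD `X = Σ_j φ_j ∂_j` near the toron valley (`X·F₀ ≥ 2(1−ε)F₀`, `div X ≤ 18L⁴ − 2c′`) by integration by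
parts against the ring measure — a product of Haar measures, hence invariant under right (and left) translations of every variable,
so that NO boundary terms, NO Jacobians, NO flows and NO charts enter.  This file is the generic engine (pure measure theory on a
group `G` with a finite right- or left-invariant measure; nothing lattice-specific):

* §1 `integral_deriv_eq_zero_of_mulRight` ∕ `_of_mulLeft` — for a curve `γ : ℝ → G` and a bounded measurable `ψ` such that
  `s ↦ ψ(x·γ(s))` is differentiable near `0` with a uniformly bounded derivative `D s x`: `∫ D 0 dμ = 0`
  (the function `s ↦ ∫ ψ(x·γ(s)) dμ(x)` is CONSTANT by invariance (`integral_mul_right_eq_self`) and differentiable under the integral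
  sign (`hasDerivAt_integral_of_dominated_loc_of_deriv_le`); uniqueness of derivatives);
* §2 `integral_deriv_mul_exp_eq_of_mulRight` — the GIBBS PAIRING for one direction: with `γ 0 = 1`,
  `∫ (∂φ)(x) e^{−βF(x)} dμ = β ∫ φ(x) (∂F)(x) e^{−βF(x)} dμ` (`∂` = derivative at `s = 0` along `s ↦ x·γ(s)`), from §1 applied to
  `ψ = φ·e^{−βF}`; §3 `sum_integral_deriv_mul_exp_eq_of_mulRight` — finitely many directions: `∫ (div X) e^{−βF} = β ∫ (X·F) e^{−βF}`
  for `X = Σ_j φ_j ∂_j`;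
* §4 `virial_mean_le` — the VIRIAL MEAN INEQUALITY on any measure space: a pairing `∫ d·e^{−βF} = β∫ g·e^{−βF}` with
  `g ≥ 2(1−ε)F − E` and `d ≤ D` pointwise gives `2(1−ε)·β∫F e^{−βF} ≤ D∫e^{−βF} + β∫E e^{−βF}`, and the ratio form
  `virial_gibbsMean_le`: `β⟨F⟩_β ≤ (D + β⟨E⟩_β) / (2(1−ε))`;
* §5 `integral_error_mul_exp_le` ∕ `exp_mul_measure_le_integral_exp` ∕ `gibbsMean_error_le` — TAIL ALGEBRA for an error term
  `E ≤ E_max` vanishing on `{F < t₁}`: `∫E e^{−βF} ≤ E_max e^{−βt₁} μ(univ)` and `∫ e^{−βF} ≥ e^{−βs} μ{F ≤ s}`, so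
  `⟨E⟩_β ≤ E_max · e^{−β(t₁−s)} · μ.real univ / μ.real{F ≤ s}` (with `s = t₁/2` and the volume FLOOR
  ✓`VolumeFloor.exp_le_ringMeasure_real_deficit_le` downstream, exponentially small in `βt₁`).

HONEST FRAMING: generic real analysis ∕ measure theory (Mathlib only); no stub / crux / rung / summit is closed by this file; ⟨24141⟩
stays OPEN; the Yang–Mills mass gap is NOT proved; no summit is proved by a line.  THEOREMS ONLY (0 `def`, 0 `sorry`), standard axioms.
Width seat `ym-line-sfw-p2-w3` g58 (cell ym-idea-1, free hands), `--supports stmt-QuantumFields-24141`.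
References: [cite: Griffiths1964] (integration by parts ∕ virial identities for Gibbs means); [cite: MontvayMunster1994, (3.145)].
-/

set_option autoImplicit false

noncomputable section

open MeasureTheory Set Filter Metric
open scoped Topology BigOperators

namespace Summit.QuantumFields.YangMills.Theorems.VirialFluxGap.HaarIBP

/-! ## §1 The derivative along a translation curve integrates to zero -/

section Invariant

variable {G : Type*} [Group G] [MeasurableSpace G] [MeasurableMul G] (μ : Measure G) [IsFiniteMeasure μ]

/-- ★★ **Integration by parts against a right-invariant finite measure, abstract form.**  Let `γ : ℝ → G` be any curve and
`ψ : G → ℝ` bounded measurable such that, for every `x`, `s ↦ ψ(x·γ(s))` has derivative `D s x` at every `s` with `|s| < ε`, with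
`|D s x| ≤ B` uniformly and `D 0` a.e.-strongly measurable.  Then `∫ D 0 dμ = 0`: the function `s ↦ ∫ ψ(x·γ(s)) dμ(x)` is constant
(right invariance) and may be differentiated under the integral sign. [cite: Griffiths1964] -/
theorem integral_deriv_eq_zero_of_mulRight [μ.IsMulRightInvariant] (γ : ℝ → G) {ψ : G → ℝ} (hψm : Measurable ψ)
    {C : ℝ} (hψb : ∀ x, |ψ x| ≤ C) {D : ℝ → G → ℝ} {ε : ℝ} (hε : 0 < ε)
    (hD : ∀ x, ∀ s ∈ ball (0 : ℝ) ε, HasDerivAt (fun s' => ψ (x * γ s')) (D s x) s)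
    {B : ℝ} (hDb : ∀ x, ∀ s ∈ ball (0 : ℝ) ε, |D s x| ≤ B) (hD0m : AEStronglyMeasurable (D 0) μ) :
    ∫ x, D 0 x ∂μ = 0 := by
  -- the parametric integral is constant
  have hconst : ∀ s : ℝ, ∫ x, ψ (x * γ s) ∂μ = ∫ x, ψ x ∂μ := fun s => integral_mul_right_eq_self ψ (γ s)
  -- differentiate under the integral sign
  have hmeas : ∀ s : ℝ, AEStronglyMeasurable (fun x => ψ (x * γ s)) μ := fun s =>
    (hψm.comp (measurable_mul_const (γ s))).aestronglyMeasurable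
  have hint : Integrable (fun x => ψ (x * γ 0)) μ := by
    refine (integrable_const C).mono' (hmeas 0) (Eventually.of_forall fun x => ?_)
    rw [Real.norm_eq_abs]; exact hψb _
  have hderiv := (hasDerivAt_integral_of_dominated_loc_of_deriv_le (μ := μ) (F := fun s x => ψ (x * γ s)) (F' := D)
    (x₀ := (0 : ℝ)) (bound := fun _ => B) (ball_mem_nhds (0 : ℝ) hε) (Eventually.of_forall hmeas) hint hD0m
    (Eventually.of_forall fun x s hs => by rw [Real.norm_eq_abs]; exact hDb x s hs) (integrable_const B)
    (Eventually.of_forall fun x s hs => hD x s hs)).2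
  -- the constant function has derivative zero
  have hzero : HasDerivAt (fun s : ℝ => ∫ x, ψ (x * γ s) ∂μ) 0 0 := by
    have h : (fun s : ℝ => ∫ x, ψ (x * γ s) ∂μ) = fun _ => ∫ x, ψ x ∂μ := funext hconst
    rw [h]; exact hasDerivAt_const _ _
  exact hderiv.unique hzero

/-- ★★ The same against a LEFT-invariant finite measure, along `s ↦ γ(s)·x`. [cite: Griffiths1964] -/
theorem integral_deriv_eq_zero_of_mulLeft [μ.IsMulLeftInvariant] (γ : ℝ → G) {ψ : G → ℝ} (hψm : Measurable ψ)
    {C : ℝ} (hψb : ∀ x, |ψ x| ≤ C) {D : ℝ → G → ℝ} {ε : ℝ} (hε : 0 < ε)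
    (hD : ∀ x, ∀ s ∈ ball (0 : ℝ) ε, HasDerivAt (fun s' => ψ (γ s' * x)) (D s x) s)
    {B : ℝ} (hDb : ∀ x, ∀ s ∈ ball (0 : ℝ) ε, |D s x| ≤ B) (hD0m : AEStronglyMeasurable (D 0) μ) :
    ∫ x, D 0 x ∂μ = 0 := by
  have hconst : ∀ s : ℝ, ∫ x, ψ (γ s * x) ∂μ = ∫ x, ψ x ∂μ := fun s => integral_mul_left_eq_self ψ (γ s)
  have hmeas : ∀ s : ℝ, AEStronglyMeasurable (fun x => ψ (γ s * x)) μ := fun s =>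
    (hψm.comp (measurable_const_mul (γ s))).aestronglyMeasurable
  have hint : Integrable (fun x => ψ (γ 0 * x)) μ := by
    refine (integrable_const C).mono' (hmeas 0) (Eventually.of_forall fun x => ?_)
    rw [Real.norm_eq_abs]; exact hψb _
  have hderiv := (hasDerivAt_integral_of_dominated_loc_of_deriv_le (μ := μ) (F := fun s x => ψ (γ s * x)) (F' := D)
    (x₀ := (0 : ℝ)) (bound := fun _ => B) (ball_mem_nhds (0 : ℝ) hε) (Eventually.of_forall hmeas) hint hD0m
    (Eventually.of_forall fun x s hs => by rw [Real.norm_eq_abs]; exact hDb x s hs) (integrable_const B)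
    (Eventually.of_forall fun x s hs => hD x s hs)).2
  have hzero : HasDerivAt (fun s : ℝ => ∫ x, ψ (γ s * x) ∂μ) 0 0 := by
    have h : (fun s : ℝ => ∫ x, ψ (γ s * x) ∂μ) = fun _ => ∫ x, ψ x ∂μ := funext hconst
    rw [h]; exact hasDerivAt_const _ _
  exact hderiv.unique hzero

/-! ## §2 The Gibbs pairing for one direction -/

/-- ★★★ **Gibbs ∕ virial pairing, one direction.**  Let `γ : ℝ → G` be a curve with `γ 0 = 1`, and let `φ, F : G → ℝ` be measurable
with `|φ| ≤ Cφ`, `m ≤ F`, such that along `s ↦ x·γ(s)` both are differentiable for `|s| < ε` with derivatives `Dφ s x`, `DF s x` bounded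
by `Bφ`, `BF`, and `Dφ 0`, `DF 0` strongly measurable.  Then for every `β ≥ 0`
`∫ (Dφ 0)(x)·e^{−βF(x)} dμ = β·∫ φ(x)·(DF 0)(x)·e^{−βF(x)} dμ`.
(§1 for `ψ = φ·e^{−βF}`, whose derivative along the curve is `Dφ·e^{−βF} − βφ·DF·e^{−βF}`.) [cite: Griffiths1964] -/
theorem integral_deriv_mul_exp_eq_of_mulRight [μ.IsMulRightInvariant] {γ : ℝ → G} (hγ : γ 0 = 1)
    {φ F : G → ℝ} (hφm : Measurable φ) (hFm : Measurable F)
    {Cφ m : ℝ} (hφb : ∀ x, |φ x| ≤ Cφ) (hFb : ∀ x, m ≤ F x)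
    {Dφ DF : ℝ → G → ℝ} {ε : ℝ} (hε : 0 < ε)
    (hDφ : ∀ x, ∀ s ∈ ball (0 : ℝ) ε, HasDerivAt (fun s' => φ (x * γ s')) (Dφ s x) s)
    (hDF : ∀ x, ∀ s ∈ ball (0 : ℝ) ε, HasDerivAt (fun s' => F (x * γ s')) (DF s x) s)
    {Bφ BF : ℝ} (hDφb : ∀ x, ∀ s ∈ ball (0 : ℝ) ε, |Dφ s x| ≤ Bφ) (hDFb : ∀ x, ∀ s ∈ ball (0 : ℝ) ε, |DF s x| ≤ BF)
    (hDφm : StronglyMeasurable (Dφ 0)) (hDFm : StronglyMeasurable (DF 0)) {β : ℝ} (hβ : 0 ≤ β) :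
    ∫ x, Dφ 0 x * Real.exp (-(β * F x)) ∂μ = β * ∫ x, φ x * DF 0 x * Real.exp (-(β * F x)) ∂μ := by
  -- the product `ψ = φ · e^{−βF}` and its derivative along the curve
  set ψ : G → ℝ := fun x => φ x * Real.exp (-(β * F x)) with hψ
  set D : ℝ → G → ℝ := fun s x =>
    Dφ s x * Real.exp (-(β * F (x * γ s))) + φ (x * γ s) * (Real.exp (-(β * F (x * γ s))) * (-(β * DF s x))) with hDdef
  have hψm : Measurable ψ := hφm.mul ((hFm.const_mul β).neg.exp)
  have hexp_le : ∀ y, Real.exp (-(β * F y)) ≤ Real.exp (-(β * m)) := fun y => by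
    apply Real.exp_le_exp.2
    have := mul_le_mul_of_nonneg_left (hFb y) hβ
    linarith
  have hCφ : 0 ≤ Cφ := (abs_nonneg _).trans (hφb 1)
  have hψb : ∀ x, |ψ x| ≤ Cφ * Real.exp (-(β * m)) := fun x => by
    rw [hψ, abs_mul, abs_of_pos (Real.exp_pos _)]
    exact mul_le_mul (hφb x) (hexp_le x) (Real.exp_pos _).le hCφ
  have hD : ∀ x, ∀ s ∈ ball (0 : ℝ) ε, HasDerivAt (fun s' => ψ (x * γ s')) (D s x) s := fun x s hs => by
    have h1 := hDφ x s hs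
    have h2 : HasDerivAt (fun s' => Real.exp (-(β * F (x * γ s')))) (Real.exp (-(β * F (x * γ s))) * (-(β * DF s x))) s :=
      (((hDF x s hs).const_mul β).neg).exp
    exact h1.mul h2
  have hBφ : 0 ≤ Bφ := (abs_nonneg _).trans (hDφb 1 0 (mem_ball_self hε))
  have hBF : 0 ≤ BF := (abs_nonneg _).trans (hDFb 1 0 (mem_ball_self hε))
  have hDb : ∀ x, ∀ s ∈ ball (0 : ℝ) ε, |D s x| ≤ (Bφ + Cφ * (β * BF)) * Real.exp (-(β * m)) := fun x s hs => by
    have e0 : 0 < Real.exp (-(β * F (x * γ s))) := Real.exp_pos _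
    have h1 : |Dφ s x * Real.exp (-(β * F (x * γ s)))| ≤ Bφ * Real.exp (-(β * m)) := by
      rw [abs_mul, abs_of_pos e0]
      exact mul_le_mul (hDφb x s hs) (hexp_le _) e0.le hBφ
    have h2 : |φ (x * γ s) * (Real.exp (-(β * F (x * γ s))) * (-(β * DF s x)))| ≤ Cφ * (β * BF) * Real.exp (-(β * m)) := by
      rw [abs_mul, abs_mul, abs_of_pos e0, abs_neg, abs_mul, abs_of_nonneg hβ]
      have h3 : β * |DF s x| ≤ β * BF := mul_le_mul_of_nonneg_left (hDFb x s hs) hβ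
      calc |φ (x * γ s)| * (Real.exp (-(β * F (x * γ s))) * (β * |DF s x|))
          ≤ Cφ * (Real.exp (-(β * m)) * (β * BF)) :=
            mul_le_mul (hφb _) (mul_le_mul (hexp_le _) h3 (by positivity) (Real.exp_pos _).le) (by positivity) hCφ
        _ = Cφ * (β * BF) * Real.exp (-(β * m)) := by ring
    calc |D s x| ≤ |Dφ s x * Real.exp (-(β * F (x * γ s)))| + |φ (x * γ s) * (Real.exp (-(β * F (x * γ s))) * (-(β * DF s x)))| :=
          abs_add_le _ _
      _ ≤ Bφ * Real.exp (-(β * m)) + Cφ * (β * BF) * Real.exp (-(β * m)) := add_le_add h1 h2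
      _ = (Bφ + Cφ * (β * BF)) * Real.exp (-(β * m)) := by ring
  -- `D 0` unfolded at `γ 0 = 1`
  have hD0 : D 0 = fun x => Dφ 0 x * Real.exp (-(β * F x)) - β * (φ x * DF 0 x * Real.exp (-(β * F x))) := by
    funext x; simp only [hDdef, hγ, mul_one]; ring
  have hD0m : AEStronglyMeasurable (D 0) μ := by
    rw [hD0]
    refine (StronglyMeasurable.sub (hDφm.mul ((hFm.const_mul β).neg.exp.stronglyMeasurable)) ?_).aestronglyMeasurable
    exact ((hφm.stronglyMeasurable.mul hDFm).mul ((hFm.const_mul β).neg.exp.stronglyMeasurable)).const_mul β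
  have hzero := integral_deriv_eq_zero_of_mulRight μ γ hψm hψb hε hD hDb hD0m
  rw [hD0] at hzero
  -- split the integral
  have hi1 : Integrable (fun x => Dφ 0 x * Real.exp (-(β * F x))) μ := by
    refine (integrable_const (Bφ * Real.exp (-(β * m)))).mono'
      (hDφm.mul ((hFm.const_mul β).neg.exp.stronglyMeasurable)).aestronglyMeasurable (Eventually.of_forall fun x => ?_)
    rw [Real.norm_eq_abs, abs_mul, abs_of_pos (Real.exp_pos _)]
    exact mul_le_mul (hDφb x 0 (mem_ball_self hε)) (hexp_le x) (Real.exp_pos _).le hBφ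
  have hi2 : Integrable (fun x => φ x * DF 0 x * Real.exp (-(β * F x))) μ := by
    refine (integrable_const (Cφ * BF * Real.exp (-(β * m)))).mono'
      ((hφm.stronglyMeasurable.mul hDFm).mul ((hFm.const_mul β).neg.exp.stronglyMeasurable)).aestronglyMeasurable
      (Eventually.of_forall fun x => ?_)
    rw [Real.norm_eq_abs, abs_mul, abs_mul, abs_of_pos (Real.exp_pos _)]
    exact mul_le_mul (mul_le_mul (hφb x) (hDFb x 0 (mem_ball_self hε)) (abs_nonneg _) hCφ) (hexp_le x)
      (Real.exp_pos _).le (by positivity)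
  rw [integral_sub hi1 (hi2.const_mul β), integral_const_mul, sub_eq_zero] at hzero
  exact hzero

/-! ## §3 Finitely many directions: `∫ (div X) e^{−βF} = β ∫ (X·F) e^{−βF}` -/

/-- ★★★ **Gibbs ∕ virial pairing for a coefficient field `X = Σ_j φ_j ∂_j`** (finitely many directions `j`, each with its own
translation curve `γ_j`, `γ_j 0 = 1`): `∫ (Σ_j ∂_jφ_j) e^{−βF} dμ = β ∫ (Σ_j φ_j ∂_jF) e^{−βF} dμ` — «divergence against the Gibbs
weight equals `β` times the field applied to the exponent».  Hypotheses per direction as in `integral_deriv_mul_exp_eq_of_mulRight`.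
[cite: Griffiths1964] -/
theorem sum_integral_deriv_mul_exp_eq_of_mulRight [μ.IsMulRightInvariant] {J : Type*} (s : Finset J)
    {γ : J → ℝ → G} (hγ : ∀ j ∈ s, γ j 0 = 1)
    {φ : J → G → ℝ} {F : G → ℝ} (hφm : ∀ j ∈ s, Measurable (φ j)) (hFm : Measurable F)
    {Cφ : J → ℝ} {m : ℝ} (hφb : ∀ j ∈ s, ∀ x, |φ j x| ≤ Cφ j) (hFb : ∀ x, m ≤ F x)
    {Dφ DF : J → ℝ → G → ℝ} {ε : ℝ} (hε : 0 < ε)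
    (hDφ : ∀ j ∈ s, ∀ x, ∀ t ∈ ball (0 : ℝ) ε, HasDerivAt (fun s' => φ j (x * γ j s')) (Dφ j t x) t)
    (hDF : ∀ j ∈ s, ∀ x, ∀ t ∈ ball (0 : ℝ) ε, HasDerivAt (fun s' => F (x * γ j s')) (DF j t x) t)
    {Bφ BF : J → ℝ} (hDφb : ∀ j ∈ s, ∀ x, ∀ t ∈ ball (0 : ℝ) ε, |Dφ j t x| ≤ Bφ j)
    (hDFb : ∀ j ∈ s, ∀ x, ∀ t ∈ ball (0 : ℝ) ε, |DF j t x| ≤ BF j)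
    (hDφm : ∀ j ∈ s, StronglyMeasurable (Dφ j 0)) (hDFm : ∀ j ∈ s, StronglyMeasurable (DF j 0)) {β : ℝ} (hβ : 0 ≤ β) :
    ∫ x, (∑ j ∈ s, Dφ j 0 x) * Real.exp (-(β * F x)) ∂μ =
      β * ∫ x, (∑ j ∈ s, φ j x * DF j 0 x) * Real.exp (-(β * F x)) ∂μ := by
  have hexp_le : ∀ y, Real.exp (-(β * F y)) ≤ Real.exp (-(β * m)) := fun y => by
    apply Real.exp_le_exp.2
    have := mul_le_mul_of_nonneg_left (hFb y) hβ
    linarith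
  have hem : StronglyMeasurable fun x => Real.exp (-(β * F x)) := (hFm.const_mul β).neg.exp.stronglyMeasurable
  have hi1 : ∀ j ∈ s, Integrable (fun x => Dφ j 0 x * Real.exp (-(β * F x))) μ := fun j hj => by
    have hB : 0 ≤ Bφ j := (abs_nonneg _).trans (hDφb j hj 1 0 (mem_ball_self hε))
    refine (integrable_const (Bφ j * Real.exp (-(β * m)))).mono' ((hDφm j hj).mul hem).aestronglyMeasurable
      (Eventually.of_forall fun x => ?_)
    rw [Real.norm_eq_abs, abs_mul, abs_of_pos (Real.exp_pos _)]
    exact mul_le_mul (hDφb j hj x 0 (mem_ball_self hε)) (hexp_le x) (Real.exp_pos _).le hB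
  have hi2 : ∀ j ∈ s, Integrable (fun x => φ j x * DF j 0 x * Real.exp (-(β * F x))) μ := fun j hj => by
    have hC : 0 ≤ Cφ j := (abs_nonneg _).trans (hφb j hj 1)
    have hB : 0 ≤ BF j := (abs_nonneg _).trans (hDFb j hj 1 0 (mem_ball_self hε))
    refine (integrable_const (Cφ j * BF j * Real.exp (-(β * m)))).mono'
      (((hφm j hj).stronglyMeasurable.mul (hDFm j hj)).mul hem).aestronglyMeasurable (Eventually.of_forall fun x => ?_)
    rw [Real.norm_eq_abs, abs_mul, abs_mul, abs_of_pos (Real.exp_pos _)]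
    exact mul_le_mul (mul_le_mul (hφb j hj x) (hDFb j hj x 0 (mem_ball_self hε)) (abs_nonneg _) hC) (hexp_le x)
      (Real.exp_pos _).le (by positivity)
  have hL : ∫ x, (∑ j ∈ s, Dφ j 0 x) * Real.exp (-(β * F x)) ∂μ = ∑ j ∈ s, ∫ x, Dφ j 0 x * Real.exp (-(β * F x)) ∂μ := by
    rw [← integral_finsetSum s hi1]
    exact integral_congr_ae (Eventually.of_forall fun x => by simp [Finset.sum_mul])
  have hR : ∫ x, (∑ j ∈ s, φ j x * DF j 0 x) * Real.exp (-(β * F x)) ∂μ =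
      ∑ j ∈ s, ∫ x, φ j x * DF j 0 x * Real.exp (-(β * F x)) ∂μ := by
    rw [← integral_finsetSum s hi2]
    exact integral_congr_ae (Eventually.of_forall fun x => by simp [Finset.sum_mul])
  rw [hL, hR, Finset.mul_sum]
  exact Finset.sum_congr rfl fun j hj =>
    integral_deriv_mul_exp_eq_of_mulRight μ (hγ j hj) (hφm j hj) hFm (hφb j hj) hFb hε (hDφ j hj) (hDF j hj)
      (hDφb j hj) (hDFb j hj) (hDφm j hj) (hDFm j hj) hβ

end Invariant

/-! ## §4 The virial mean inequality (any measure space) -/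

section Virial

variable {Ω : Type*} [MeasurableSpace Ω] (μ : Measure Ω)

/-- ★★★ **Virial mean inequality.**  On any measure space, suppose the pairing `∫ d·e^{−βF} dμ = β·∫ g·e^{−βF} dμ` holds (the Gibbs
pairing of §3 with `d = div X`, `g = X·F`), and pointwise `g ≥ 2(1−ε)F − E`, `d ≤ D`, with `β ≥ 0` and the four weighted functions
integrable.  Then `2(1−ε)·β·∫F e^{−βF} dμ ≤ D·∫e^{−βF} dμ + β·∫E e^{−βF} dμ`. [cite: Griffiths1964] -/
theorem virial_mean_le {F g d E : Ω → ℝ} {β D ε : ℝ} (hβ : 0 ≤ β)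
    (hpair : ∫ x, d x * Real.exp (-(β * F x)) ∂μ = β * ∫ x, g x * Real.exp (-(β * F x)) ∂μ)
    (hg : ∀ x, 2 * (1 - ε) * F x - E x ≤ g x) (hd : ∀ x, d x ≤ D)
    (hFi : Integrable (fun x => F x * Real.exp (-(β * F x))) μ) (hEi : Integrable (fun x => E x * Real.exp (-(β * F x))) μ)
    (hgi : Integrable (fun x => g x * Real.exp (-(β * F x))) μ) (hdi : Integrable (fun x => d x * Real.exp (-(β * F x))) μ)
    (hZi : Integrable (fun x => Real.exp (-(β * F x))) μ) :
    2 * (1 - ε) * (β * ∫ x, F x * Real.exp (-(β * F x)) ∂μ) ≤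
      D * ∫ x, Real.exp (-(β * F x)) ∂μ + β * ∫ x, E x * Real.exp (-(β * F x)) ∂μ := by
  -- `∫ d e^{−βF} ≤ D ∫ e^{−βF}`
  have h1 : ∫ x, d x * Real.exp (-(β * F x)) ∂μ ≤ D * ∫ x, Real.exp (-(β * F x)) ∂μ := by
    rw [← integral_const_mul]
    exact integral_mono hdi (hZi.const_mul D) fun x => mul_le_mul_of_nonneg_right (hd x) (Real.exp_pos _).le
  -- `∫ g e^{−βF} ≥ 2(1−ε)∫F e^{−βF} − ∫E e^{−βF}`
  have h2 : 2 * (1 - ε) * ∫ x, F x * Real.exp (-(β * F x)) ∂μ - ∫ x, E x * Real.exp (-(β * F x)) ∂μ ≤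
      ∫ x, g x * Real.exp (-(β * F x)) ∂μ := by
    rw [← integral_const_mul, ← integral_sub (hFi.const_mul _) hEi]
    exact integral_mono ((hFi.const_mul _).sub hEi) hgi fun x => by
      have h := mul_le_mul_of_nonneg_right (hg x) (Real.exp_pos (-(β * F x))).le
      simp only at h ⊢
      nlinarith [h]
  have h3 := mul_le_mul_of_nonneg_left h2 hβ
  nlinarith [h1, h3, hpair]

/-- ★★★ **Virial mean inequality, ratio form**: under the hypotheses of `virial_mean_le` with `ε < 1` and `∫e^{−βF} dμ > 0`,
`β·⟨F⟩_β ≤ (D + β·⟨E⟩_β) / (2(1−ε))` where `⟨h⟩_β = ∫h e^{−βF}dμ / ∫e^{−βF}dμ`. [cite: Griffiths1964] -/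
theorem virial_gibbsMean_le {F g d E : Ω → ℝ} {β D ε : ℝ} (hβ : 0 ≤ β) (hε : ε < 1)
    (hpair : ∫ x, d x * Real.exp (-(β * F x)) ∂μ = β * ∫ x, g x * Real.exp (-(β * F x)) ∂μ)
    (hg : ∀ x, 2 * (1 - ε) * F x - E x ≤ g x) (hd : ∀ x, d x ≤ D)
    (hFi : Integrable (fun x => F x * Real.exp (-(β * F x))) μ) (hEi : Integrable (fun x => E x * Real.exp (-(β * F x))) μ)
    (hgi : Integrable (fun x => g x * Real.exp (-(β * F x))) μ) (hdi : Integrable (fun x => d x * Real.exp (-(β * F x))) μ)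
    (hZi : Integrable (fun x => Real.exp (-(β * F x))) μ) (hZ : 0 < ∫ x, Real.exp (-(β * F x)) ∂μ) :
    β * (∫ x, F x * Real.exp (-(β * F x)) ∂μ) / (∫ x, Real.exp (-(β * F x)) ∂μ) ≤
      (D + β * (∫ x, E x * Real.exp (-(β * F x)) ∂μ) / (∫ x, Real.exp (-(β * F x)) ∂μ)) / (2 * (1 - ε)) := by
  have h := virial_mean_le μ hβ hpair hg hd hFi hEi hgi hdi hZi
  have h2 : 0 < 2 * (1 - ε) := by linarith
  rw [le_div_iff₀ h2, div_mul_eq_mul_div, div_le_iff₀ hZ, add_mul, div_mul_cancel₀ _ hZ.ne']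
  nlinarith [h]

/-! ## §5 Tail algebra for the error term -/

/-- The Gibbs numerator of an error term `E ≤ E_max` supported on `{t₁ ≤ F}` is at most `E_max · e^{−βt₁} · μ(univ)` (`β ≥ 0`).
[folklore] -/
theorem integral_error_mul_exp_le [IsFiniteMeasure μ] {F E : Ω → ℝ} {β t₁ Emax : ℝ} (hβ : 0 ≤ β) (hEmax : 0 ≤ Emax)
    (hEle : ∀ x, E x ≤ Emax) (hEsupp : ∀ x, F x < t₁ → E x = 0) :
    ∫ x, E x * Real.exp (-(β * F x)) ∂μ ≤ Emax * Real.exp (-(β * t₁)) * μ.real univ := by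
  have hpt : ∀ x, E x * Real.exp (-(β * F x)) ≤ Emax * Real.exp (-(β * t₁)) := fun x => by
    by_cases hx : F x < t₁
    · rw [hEsupp x hx, zero_mul]; positivity
    · have hx' : t₁ ≤ F x := not_lt.1 hx
      have h1 : Real.exp (-(β * F x)) ≤ Real.exp (-(β * t₁)) := by
        apply Real.exp_le_exp.2
        have := mul_le_mul_of_nonneg_left hx' hβ
        linarith
      exact mul_le_mul (hEle x) h1 (Real.exp_pos _).le hEmax
  calc ∫ x, E x * Real.exp (-(β * F x)) ∂μ ≤ ∫ _x, Emax * Real.exp (-(β * t₁)) ∂μ := by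
        by_cases hi : Integrable (fun x => E x * Real.exp (-(β * F x))) μ
        · exact integral_mono hi (integrable_const _) hpt
        · rw [integral_undef hi]; exact integral_nonneg fun _ => by positivity
    _ = Emax * Real.exp (-(β * t₁)) * μ.real univ := by
        rw [integral_const, smul_eq_mul]; ring

/-- The Gibbs normalisation is at least `e^{−βs} · μ{F ≤ s}` for every level `s` (`β ≥ 0`, `F` measurable). [folklore] -/
theorem exp_mul_measure_le_integral_exp [IsFiniteMeasure μ] {F : Ω → ℝ} (hFm : Measurable F) {β s : ℝ} (hβ : 0 ≤ β)
    {m : ℝ} (hFb : ∀ x, m ≤ F x) :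
    Real.exp (-(β * s)) * μ.real {x | F x ≤ s} ≤ ∫ x, Real.exp (-(β * F x)) ∂μ := by
  have hS : MeasurableSet {x | F x ≤ s} := hFm measurableSet_Iic
  have hZi : Integrable (fun x => Real.exp (-(β * F x))) μ := by
    refine (integrable_const (Real.exp (-(β * m)))).mono' (hFm.const_mul β).neg.exp.aestronglyMeasurable
      (Eventually.of_forall fun x => ?_)
    rw [Real.norm_eq_abs, abs_of_pos (Real.exp_pos _)]
    apply Real.exp_le_exp.2
    have := mul_le_mul_of_nonneg_left (hFb x) hβ
    linarith
  calc Real.exp (-(β * s)) * μ.real {x | F x ≤ s}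
      = ∫ x in {x | F x ≤ s}, Real.exp (-(β * s)) ∂μ := by
        rw [setIntegral_const, smul_eq_mul, mul_comm]
    _ ≤ ∫ x in {x | F x ≤ s}, Real.exp (-(β * F x)) ∂μ := by
        refine setIntegral_mono_on (integrable_const _).integrableOn hZi.integrableOn hS fun x hx => ?_
        apply Real.exp_le_exp.2
        have := mul_le_mul_of_nonneg_left (show F x ≤ s from hx) hβ
        linarith
    _ ≤ ∫ x, Real.exp (-(β * F x)) ∂μ :=
        setIntegral_le_integral hZi (Eventually.of_forall fun x => (Real.exp_pos _).le)

/-- ★★ **Gibbs mean of a supported error term**: for `E ≤ E_max` vanishing on `{F < t₁}`, `F ≥ m` measurable, `β ≥ 0` and a level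
`s` with `μ{F ≤ s} > 0`: `⟨E⟩_β ≤ E_max · e^{−β(t₁ − s)} · μ(univ) / μ{F ≤ s}`.  With `s = t₁/2` and the volume floor this is
exponentially small in `βt₁` as soon as `βt₁/2` exceeds the floor exponent. [folklore] -/
theorem gibbsMean_error_le [IsFiniteMeasure μ] {F E : Ω → ℝ} (hFm : Measurable F) {β t₁ s Emax m : ℝ} (hβ : 0 ≤ β)
    (hEmax : 0 ≤ Emax) (hEle : ∀ x, E x ≤ Emax) (hEsupp : ∀ x, F x < t₁ → E x = 0)
    (hFb : ∀ x, m ≤ F x) (hpos : 0 < μ.real {x | F x ≤ s}) :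
    (∫ x, E x * Real.exp (-(β * F x)) ∂μ) / (∫ x, Real.exp (-(β * F x)) ∂μ) ≤
      Emax * Real.exp (-(β * (t₁ - s))) * μ.real univ / μ.real {x | F x ≤ s} := by
  have hnum := integral_error_mul_exp_le μ hβ hEmax hEle hEsupp (F := F) (t₁ := t₁)
  have hden := exp_mul_measure_le_integral_exp μ hFm hβ hFb (s := s)
  have hden_pos : 0 < Real.exp (-(β * s)) * μ.real {x | F x ≤ s} := mul_pos (Real.exp_pos _) hpos
  have hZ : 0 < ∫ x, Real.exp (-(β * F x)) ∂μ := hden_pos.trans_le hden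
  rw [div_le_div_iff₀ hZ hpos]
  have hsplit : Real.exp (-(β * t₁)) = Real.exp (-(β * (t₁ - s))) * Real.exp (-(β * s)) := by
    rw [← Real.exp_add]; ring_nf
  calc (∫ x, E x * Real.exp (-(β * F x)) ∂μ) * μ.real {x | F x ≤ s}
      ≤ Emax * Real.exp (-(β * t₁)) * μ.real univ * μ.real {x | F x ≤ s} := mul_le_mul_of_nonneg_right hnum hpos.le
    _ = Emax * Real.exp (-(β * (t₁ - s))) * μ.real univ * (Real.exp (-(β * s)) * μ.real {x | F x ≤ s}) := by
        rw [hsplit]; ring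
    _ ≤ Emax * Real.exp (-(β * (t₁ - s))) * μ.real univ * ∫ x, Real.exp (-(β * F x)) ∂μ :=
        mul_le_mul_of_nonneg_left hden (by positivity)

end Virial

end Summit.QuantumFields.YangMills.Theorems.VirialFluxGap.HaarIBP

end
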